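import Mathlib
import Summits.QuantumFields.YangMills.Theses.ThermodynamicCeilings

/-!
# Route `ThermodynamicCeilings` — glue of the split of `TopBandCeilingC` (LINE E)

`TopBandPointGlue : TopBandPointCeiling → MirrorMonotoneDecay → TopBandCeilingC`: the single-separation top-band ceiling at
t₂ = 2R₂+2 plus the reflection-positivity monotone decay of the centred on-axis mirror covariance (0 ≤ c_L(t+1) ≤ c_L(t) for
2 ≤ t, t+1 ≤ L, β ≥ 0) give the band ceiling on [2R₂+2, L]; the β-threshold is enlarged to max(β₄, 0).  Pure bookkeeping +
induction on the separation.  Proves only this implication; no summit / leaf / NT / UV / IR statement is proved here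
(D-0145 ideator ym-idea-11 g5, lens «wuc»).
-/

set_option autoImplicit false

namespace Summit.QuantumFields.YangMills.Theses.ThermodynamicCeilings

open Literature.MathematicalPhysics.QuantumFieldTheory Literature.MathematicalPhysics.QuantumLattice
  Summit.QuantumFields.YangMills.Cruxes.OSLegsFromFemtoAndGap.DlrCollarTransfer in
/-- closes the glue item `TopBandPointGlue` (stmt-QuantumFields-27772): the single-separation top-band ceiling plus the
reflection-positivity monotone decay of the on-axis mirror covariance give the band ceiling on `[2R₂+2, L]`. -/
theorem topBandPointGlue_proof : TopBandPointGlue := by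
  intro hP hMono
  unfold TopBandCeilingC Summit.QuantumFields.YangMills.Theses.AntiScreeningCeilings.TopBandCeiling
  intro G _ _ _ _ hG hSU r v f g h Λ₅
  letI : MeasurableSpace G := borel G
  haveI : BorelSpace G := ⟨rfl⟩
  obtain ⟨ε₀, hε₀, H⟩ := hP G hG hSU r v f g h Λ₅
  refine ⟨ε₀, hε₀, fun ε hε hεle hfl => ?_⟩
  obtain ⟨ℓ₄, hℓ₄, H2⟩ := H ε hε hεle hfl
  refine ⟨ℓ₄, hℓ₄, fun ℓ hℓ hℓle => ?_⟩
  obtain ⟨C, β₄, hC, H3⟩ := H2 ℓ hℓ hℓle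
  refine ⟨C, max β₄ 0, hC, fun β hβ s hs hs1 hsub hnear L q k R₂ t hq hR₂ hRs hL hband ht htL => ?_⟩
  have hβ₄ : β₄ ≤ β := le_trans (le_max_left _ _) hβ
  have hβ0 : 0 ≤ β := le_trans (le_max_right _ _) hβ
  have key := H3 β hβ₄ s hs hs1 hsub hnear L q k R₂ hq hR₂ hRs hL hband
  -- monotone decay from 2R₂+2 up to t
  have hM := hMono G hG hSU r β L q k
  -- c as a function of the separation
  set c : ℕ → ℝ := fun u => torusE G r β L (fun U => (plane G r q (fun i => if i = k then ((u : ℕ) : ℤ) else 0) U - torusE G r β L (plane G r q (fun i => if i = k then ((u : ℕ) : ℤ) else 0))) * (plane G r q (fun _ => 0) U - torusE G r β L (plane G r q (fun _ => 0)))) with hc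
  have hstep : ∀ u : ℕ, 2 ≤ u → u + 1 ≤ L → 0 ≤ c (u + 1) ∧ c (u + 1) ≤ c u := by
    intro u hu huL
    simpa [hc] using hM u hβ0 hq hu huL
  have hind : ∀ n : ℕ, 2 * R₂ + 2 + n ≤ L → 0 ≤ c (2 * R₂ + 2 + n) ∧ c (2 * R₂ + 2 + n) ≤ c (2 * R₂ + 2) := by
    intro n
    induction n with
    | zero =>
      intro hnL
      refine ⟨?_, le_of_eq (by simp)⟩
      have h1 := hstep (2 * R₂ + 1) (by omega) (by omega)
      have : 2 * R₂ + 1 + 1 = 2 * R₂ + 2 := by ring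
      rw [this] at h1
      simpa using h1.1
    | succ n ih =>
      intro hnL
      have ih' := ih (by omega)
      have h1 := hstep (2 * R₂ + 2 + n) (by omega) (by omega)
      have e : 2 * R₂ + 2 + (n + 1) = 2 * R₂ + 2 + n + 1 := by ring
      rw [e]
      exact ⟨h1.1, le_trans h1.2 ih'.2⟩
  obtain ⟨n, rfl⟩ : ∃ n, t = 2 * R₂ + 2 + n := ⟨t - (2 * R₂ + 2), by omega⟩
  have hh := hind n htL
  have h0 : 0 ≤ c (2 * R₂ + 2) := by simpa using (hind 0 (by omega)).1
  have habs : |c (2 * R₂ + 2 + n)| ≤ |c (2 * R₂ + 2)| := by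
    rw [abs_of_nonneg hh.1, abs_of_nonneg h0]
    exact hh.2
  have key' : |c (2 * R₂ + 2)| ≤ (C / (R₂ : ℝ) ^ 4) ^ 2 := by simpa [hc] using key
  have goal : |c (2 * R₂ + 2 + n)| ≤ (C / (R₂ : ℝ) ^ 4) ^ 2 := le_trans habs key'
  simpa [hc] using goal

end Summit.QuantumFields.YangMills.Theses.ThermodynamicCeilings
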